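import Summits.Ventures.HodgeRepro2.T5SU11RadialGreenImproperUnique

/-!
# The improper Green's operator maps the exponentially decaying class to itself

For a source `g` of the class of rows 496–497 at the parameter `λ₂ > 1` (continuous on `(0, ∞)`, bounded on `(0, 1]`,
`|g(s)| ≤ C e^{−εs}` for `s ≥ s₀`, `ε > 2 − λ₂`), the improper Green's solution `u = G^I_{λ₂} g` is again

* continuous on `(0, ∞)` (`continuousOn_greenSolI`) and **bounded on `(0, 1]`** (`exists_abs_greenSolI_le_of_le_one`:
  row 493's bound near `0` and continuity on a compact interval), and
* **exponentially decaying at every rate `ε′ < min(ε, λ₂)`** (`exists_abs_greenSolI_le_exp`): `|χ_{λ₂} B^I| ≤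
  2L e^{−λ₂ t}(C₀ + C′ t e^{max(λ₂−ε,0) t})` and `|φ_{λ₂} A^I| ≤ 2c e^{(λ₂−2)t} · C″ e^{(2−λ₂−ε)t}/(λ₂ + ε − 2)`
  (`abs_greenBI_le_atTop`, `abs_greenAI_le_exp`: the tail integral `∫_{(t,∞)} e^{−κs} = e^{−κt}/κ`), so
  `|u(t)| ≤ K (1 + t) e^{−min(ε,λ₂) t}` (`abs_greenSolI_le_atTop`) and the factor `1 + t` is absorbed into a
  slightly smaller rate (`t ≤ e^{δt}/δ`, row 481).

Hence `G^I_{λ₂} g` is an admissible source for `G^I_λ` whenever `min(ε, λ₂) > 2 − λ`, which is the hypothesis of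
the resolvent identity on the class (next row). Nothing is claimed about (N).

Blind lane: Mathlib + the HodgeRepro2 prefix only; no sorry; axioms ⊆ {propext, Classical.choice,
Quot.sound}.
-/

namespace Summit.Ventures.HodgeRepro2.T5SU11RadialGreenImproperStable

open Filter Topology MeasureTheory intervalIntegral
open Set (Ioi Ioc Icc Ioo)
open T5SU11Cartan T5SU11SphericalFunction T5SU11SphericalBounds T5SU11SphericalContinuous
  T5SU11SphericalSolutionSpaceAll T5SU11ReductionOfOrder T5SU11ReductionOfOrderInfinity T5SU11SphericalDecay
  T5SU11SphericalDecayAsymptotic T5SU11SphericalDecayBracket T5SU11ResolventBoundary T5SU11ResolventDiagonalEdge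
  T5SU11RadialGreenImproper T5SU11RadialGreenImproperOrigin T5SU11ResolventSourceIntegrable
  T5SU11RadialGreenImproperDecaySource T5SU11RadialGreenImproperUnique

/-- `∫_{(t,∞)} e^{−κ s} ds = e^{−κ t}/κ` for `κ > 0`. -/
theorem integral_exp_neg_mul_Ioi {κ : ℝ} (hκ : 0 < κ) (t : ℝ) :
    ∫ s in Ioi t, Real.exp (-κ * s) = Real.exp (-κ * t) / κ := by
  have h := integral_comp_mul_left_Ioi (fun x => Real.exp (-x)) t hκ
  simp only [smul_eq_mul] at h
  rw [integral_exp_neg_Ioi] at h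
  have e : (fun s => Real.exp (-κ * s)) = fun x => Real.exp (-(κ * x)) := by
    funext s
    rw [neg_mul]
  rw [e, h, div_eq_inv_mul, neg_mul]

section measure

variable [MeasurableSpace Circle] [BorelSpace Circle]

variable {lam : ℝ} (hlam : 1 < lam) {g : ℝ → ℝ} (hg : ContinuousOn g (Ioi 0))
  {M : ℝ} (hM : ∀ s ∈ Ioc (0 : ℝ) 1, |g s| ≤ M) (hM0 : 0 ≤ M)
  {ε C s₀ : ℝ} (hε : 2 - lam < ε) (hC : ∀ s, s₀ ≤ s → |g s| ≤ C * Real.exp (-ε * s))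

include hlam hg hM hM0 hε hC in
/-- `G^I_λ g` is continuous on `(0, ∞)`. -/
theorem continuousOn_greenSolI :
    ContinuousOn (greenSolI (fun t => sph lam (hyp t)) (sphDecay lam) g) (Ioi 0) :=
  fun _ ht => (hasDerivAt_greenSolI (hφ_sph lam) (fun _ hs => hasDerivAt_sphDecay hlam hs) hg
    (integrableOn_sph_mul_mul_sinh_Ioc hg hM hM0 lam) (integrableOn_sphDecay_mul_mul_sinh hlam hg hM hM0 hε hC)
    ht).continuousAt.continuousWithinAt

include hlam hg hM hM0 hε hC in
/-- **`G^I_λ g` is bounded on `(0, 1]`.** -/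
theorem exists_abs_greenSolI_le_of_le_one :
    ∃ M' : ℝ, 0 ≤ M' ∧ ∀ s ∈ Ioc (0 : ℝ) 1, |greenSolI (fun t => sph lam (hyp t)) (sphDecay lam) g s| ≤ M' := by
  obtain ⟨B, hB⟩ := eventually_abs_greenSolI_le hlam hM hM0 (integrableOn_sphDecay_mul_mul_sinh hlam hg hM hM0 hε hC)
  obtain ⟨δ, hδ, hδB⟩ := mem_nhdsGT_iff_exists_Ioo_subset.mp hB
  have hδ0 : 0 < δ := hδ
  set δ' := min δ 1 with hδ'
  have hδ'0 : 0 < δ' := lt_min hδ0 one_pos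
  have hcont : ContinuousOn (greenSolI (fun t => sph lam (hyp t)) (sphDecay lam) g) (Icc δ' 1) :=
    (continuousOn_greenSolI hlam hg hM hM0 hε hC).mono (fun s hs => lt_of_lt_of_le hδ'0 hs.1)
  obtain ⟨C', hC'⟩ := isCompact_Icc.exists_bound_of_continuousOn hcont
  refine ⟨max (max B C') 0, le_max_right _ _, fun s hs => ?_⟩
  rcases lt_or_ge s δ with hsδ | hsδ
  · exact le_trans (hδB ⟨hs.1, hsδ⟩) (le_trans (le_max_left _ _) (le_max_left _ _))
  · have := hC' s ⟨le_trans (min_le_left _ _) hsδ, hs.2⟩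
    rw [Real.norm_eq_abs] at this
    exact le_trans this (le_trans (le_max_right _ _) (le_max_left _ _))

include hlam hg hM hM0 hε hC in
/-- **The tail `A^I` decays like `e^{(2−λ−ε)t}`**: for `t ≥ s₀`,
`|A^I(t)| ≤ 2L |C| e^{(2−λ−ε)t}/(2(λ + ε − 2))` where `χ_λ ≤ 2L e^{−λ s}` beyond `T₀`. -/
theorem abs_greenAI_le_exp :
    ∃ K T : ℝ, 0 ≤ K ∧ ∀ t, T ≤ t → |greenAI (sphDecay lam) g t| ≤ K * Real.exp (-(lam + ε - 2) * t) := by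
  set L := 1 / ((lam - 1) * T5SU11SphericalAsymptotic.cfun (2 - lam)) with hL
  have hLpos : 0 < L := sphDecay_limit_pos hlam
  obtain ⟨T₀, hT₀⟩ := eventually_atTop.mp (eventually_sphDecay_le hlam)
  set T := max (max T₀ s₀) 1 with hT
  have hT0 : 0 < T := lt_of_lt_of_le one_pos (le_max_right _ _)
  set κ := lam + ε - 2 with hκ
  have hκpos : 0 < κ := by rw [hκ]; linarith
  set C' := 2 * L * |C| / 2 with hC'
  have hC'0 : 0 ≤ C' := by positivity
  refine ⟨C' / κ, T, by positivity, fun t ht => ?_⟩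
  have hA := integrableOn_sphDecay_mul_mul_sinh hlam hg hM hM0 hε hC
  have hpt : ∀ s ∈ Ioi t, |sphDecay lam s * g s * Real.sinh (2 * s)| ≤ C' * Real.exp (-κ * s) := by
    intro s hs
    have hs' : t < s := hs
    have hs0 : 0 < s := lt_of_lt_of_le hT0 (le_trans ht hs'.le)
    have hb1 := hT₀ s (le_trans (le_trans (le_max_left _ _) (le_max_left _ _)) (le_trans ht hs'.le))
    have hgs := hC s (le_trans (le_trans (le_max_right _ _) (le_max_left _ _)) (le_trans ht hs'.le))
    have hCexp : C * Real.exp (-ε * s) ≤ |C| * Real.exp (-ε * s) :=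
      mul_le_mul_of_nonneg_right (le_abs_self C) (Real.exp_pos _).le
    have hsh : Real.sinh (2 * s) ≤ Real.exp (2 * s) / 2 := sinh_le_exp_div_two _
    have hsh0 : 0 ≤ Real.sinh (2 * s) := Real.sinh_nonneg_iff.mpr (by linarith)
    have hχ0 : 0 ≤ sphDecay lam s := (sphDecay_pos hlam hs0).le
    rw [abs_mul, abs_mul, abs_of_nonneg hχ0, abs_of_nonneg hsh0]
    calc sphDecay lam s * |g s| * Real.sinh (2 * s)
        ≤ (2 * L * Real.exp (-lam * s)) * (|C| * Real.exp (-ε * s)) * (Real.exp (2 * s) / 2) :=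
          mul_le_mul (mul_le_mul hb1 (le_trans hgs hCexp) (abs_nonneg _) (by positivity)) hsh hsh0
            (by positivity)
      _ = C' * Real.exp (-κ * s) := by
          rw [hC', hκ, show Real.exp (-(lam + ε - 2) * s)
              = Real.exp (-lam * s) * Real.exp (-ε * s) * Real.exp (2 * s) by
            rw [← Real.exp_add, ← Real.exp_add]; congr 1; ring]
          ring
  have hmaj : IntegrableOn (fun s => C' * Real.exp (-κ * s)) (Ioi t) :=
    (exp_neg_integrableOn_Ioi t hκpos).const_mul _
  unfold greenAI
  calc |∫ s in Ioi t, sphDecay lam s * g s * Real.sinh (2 * s)|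
      ≤ ∫ s in Ioi t, |sphDecay lam s * g s * Real.sinh (2 * s)| := by
        have := norm_integral_le_integral_norm (μ := volume.restrict (Ioi t))
          (fun s => sphDecay lam s * g s * Real.sinh (2 * s))
        simpa only [Real.norm_eq_abs] using this
    _ ≤ ∫ s in Ioi t, C' * Real.exp (-κ * s) :=
        setIntegral_mono_on (hA.mono_set (Set.Ioi_subset_Ioi (le_trans hT0.le ht))).abs hmaj measurableSet_Ioi hpt
    _ = C' / κ * Real.exp (-(lam + ε - 2) * t) := by
        rw [MeasureTheory.integral_const_mul, integral_exp_neg_mul_Ioi hκpos, hκ]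
        ring

include hlam hg hM hM0 hC in
/-- **`|B^I(t)| ≤ K (1 + t) e^{max(λ−ε,0) t}`** for `t ≥ T` (the bound inside row 497's proof, exported). -/
theorem abs_greenBI_le_atTop :
    ∃ K T : ℝ, 0 ≤ K ∧ 0 < T ∧ ∀ t, T ≤ t →
      |greenBI (fun t => sph lam (hyp t)) g t| ≤ K * (1 + t) * Real.exp (max (lam - ε) 0 * t) := by
  set c := T5SU11SphericalAsymptotic.cfun (2 - lam) with hc
  have hcpos : 0 < c := T5SU11SphericalCfun.cfun_pos (by linarith)
  obtain ⟨T₀, hT₀⟩ := eventually_atTop.mp (eventually_sph_hyp_le hlam)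
  set T := max (max T₀ s₀) 1 with hT
  have hT0 : 0 < T := lt_of_lt_of_le one_pos (le_max_right _ _)
  set Mx := max (lam - ε) 0 with hMx
  have hMx0 : 0 ≤ Mx := le_max_right _ _
  set C' := 2 * c * |C| / 2 with hC'
  have hC'0 : 0 ≤ C' := by positivity
  have hpt : ∀ s, T ≤ s → |sph lam (hyp s) * g s * Real.sinh (2 * s)| ≤ C' * Real.exp ((lam - ε) * s) := by
    intro s hs
    have hs0 : 0 < s := lt_of_lt_of_le hT0 hs
    have hb0 := hT₀ s (le_trans (le_trans (le_max_left _ _) (le_max_left _ _)) hs)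
    have hgs := hC s (le_trans (le_trans (le_max_right _ _) (le_max_left _ _)) hs)
    have hCexp : C * Real.exp (-ε * s) ≤ |C| * Real.exp (-ε * s) :=
      mul_le_mul_of_nonneg_right (le_abs_self C) (Real.exp_pos _).le
    have hsh : Real.sinh (2 * s) ≤ Real.exp (2 * s) / 2 := sinh_le_exp_div_two _
    have hsh0 : 0 ≤ Real.sinh (2 * s) := Real.sinh_nonneg_iff.mpr (by linarith)
    rw [abs_mul, abs_mul, abs_of_pos (sph_hyp_pos lam s), abs_of_nonneg hsh0]
    calc sph lam (hyp s) * |g s| * Real.sinh (2 * s)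
        ≤ (2 * c * Real.exp ((lam - 2) * s)) * (|C| * Real.exp (-ε * s)) * (Real.exp (2 * s) / 2) :=
          mul_le_mul (mul_le_mul hb0 (le_trans hgs hCexp) (abs_nonneg _) (by positivity)) hsh hsh0
            (by positivity)
      _ = C' * Real.exp ((lam - ε) * s) := by
          rw [hC', show Real.exp ((lam - ε) * s)
              = Real.exp ((lam - 2) * s) * Real.exp (-ε * s) * Real.exp (2 * s) by
            rw [← Real.exp_add, ← Real.exp_add]; congr 1; ring]
          ring
  set C₀ := ∫ s in Ioc 0 T, |sph lam (hyp s) * g s * Real.sinh (2 * s)| with hC₀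
  have hC₀0 : 0 ≤ C₀ := setIntegral_nonneg measurableSet_Ioc (fun _ _ => abs_nonneg _)
  have hBint := integrableOn_sph_mul_mul_sinh_Ioc hg hM hM0 lam
  refine ⟨C₀ + C', T, by positivity, hT0, fun t ht => ?_⟩
  have ht0 : 0 ≤ t := le_trans hT0.le ht
  have hexp1 : 1 ≤ Real.exp (Mx * t) := Real.one_le_exp (by positivity)
  unfold greenBI
  have hsplit : Ioc 0 T ∪ Ioc T t = Ioc 0 t := Set.Ioc_union_Ioc_eq_Ioc hT0.le ht
  have hdisj : Disjoint (Ioc 0 T) (Ioc T t) := Set.Ioc_disjoint_Ioc_of_le le_rfl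
  rw [← hsplit, setIntegral_union hdisj measurableSet_Ioc
    ((hBint t).mono_set (by rw [← hsplit]; exact Set.subset_union_left))
    ((hBint t).mono_set (by rw [← hsplit]; exact Set.subset_union_right))]
  have h1 : |∫ s in Ioc 0 T, sph lam (hyp s) * g s * Real.sinh (2 * s)| ≤ C₀ := by
    have := norm_integral_le_integral_norm (μ := volume.restrict (Ioc 0 T))
      (fun s => sph lam (hyp s) * g s * Real.sinh (2 * s))
    simpa only [Real.norm_eq_abs] using this
  have h2 : |∫ s in Ioc T t, sph lam (hyp s) * g s * Real.sinh (2 * s)| ≤ C' * Real.exp (Mx * t) * t := by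
    have h := norm_setIntegral_le_of_norm_le_const (μ := volume) (s := Ioc T t)
      (f := fun s => sph lam (hyp s) * g s * Real.sinh (2 * s)) (C := C' * Real.exp (Mx * t))
      (by rw [Real.volume_Ioc]; exact ENNReal.ofReal_lt_top) (fun s hs => ?_)
    · rw [Real.norm_eq_abs, Real.volume_real_Ioc_of_le ht] at h
      exact le_trans h (mul_le_mul_of_nonneg_left (by linarith) (by positivity))
    · rw [Real.norm_eq_abs]
      refine le_trans (hpt s hs.1.le) (mul_le_mul_of_nonneg_left (Real.exp_le_exp.mpr ?_) hC'0)
      have hs0 : 0 ≤ s := le_trans hT0.le hs.1.le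
      calc (lam - ε) * s ≤ Mx * s := mul_le_mul_of_nonneg_right (le_max_left _ _) hs0
        _ ≤ Mx * t := mul_le_mul_of_nonneg_left hs.2 hMx0
  calc |(∫ s in Ioc 0 T, sph lam (hyp s) * g s * Real.sinh (2 * s))
        + ∫ s in Ioc T t, sph lam (hyp s) * g s * Real.sinh (2 * s)|
      ≤ C₀ + C' * Real.exp (Mx * t) * t := le_trans (abs_add_le _ _) (add_le_add h1 h2)
    _ ≤ (C₀ + C') * (1 + t) * Real.exp (Mx * t) := by
        have hA : C₀ ≤ C₀ * (1 + t) * Real.exp (Mx * t) := by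
          calc C₀ = C₀ * 1 * 1 := by ring
            _ ≤ C₀ * (1 + t) * Real.exp (Mx * t) :=
                mul_le_mul (mul_le_mul_of_nonneg_left (by linarith) hC₀0) hexp1 zero_le_one (by positivity)
        have hB : C' * Real.exp (Mx * t) * t ≤ C' * (1 + t) * Real.exp (Mx * t) := by
          have : C' * Real.exp (Mx * t) * t = C' * t * Real.exp (Mx * t) := by ring
          rw [this]
          exact mul_le_mul_of_nonneg_right (mul_le_mul_of_nonneg_left (by linarith) hC'0) (Real.exp_pos _).le
        nlinarith [hA, hB]

include hlam hg hM hM0 hε hC in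
/-- **`|G^I_λ g(t)| ≤ K (1 + t) e^{−min(ε, λ) t}`** for `t ≥ T`. -/
theorem abs_greenSolI_le_atTop :
    ∃ K T : ℝ, 0 ≤ K ∧ 0 < T ∧ ∀ t, T ≤ t →
      |greenSolI (fun t => sph lam (hyp t)) (sphDecay lam) g t| ≤ K * (1 + t) * Real.exp (-(min ε lam) * t) := by
  set L := 1 / ((lam - 1) * T5SU11SphericalAsymptotic.cfun (2 - lam)) with hL
  have hLpos : 0 < L := sphDecay_limit_pos hlam
  set c := T5SU11SphericalAsymptotic.cfun (2 - lam) with hc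
  have hcpos : 0 < c := T5SU11SphericalCfun.cfun_pos (by linarith)
  obtain ⟨T₀, hT₀⟩ := eventually_atTop.mp (eventually_sphDecay_le hlam)
  obtain ⟨T₁, hT₁⟩ := eventually_atTop.mp (eventually_sph_hyp_le hlam)
  obtain ⟨KB, TB, hKB, hTB, hB⟩ := abs_greenBI_le_atTop hlam hg hM hM0 hC
  obtain ⟨KA, TA, hKA, hA⟩ := abs_greenAI_le_exp hlam hg hM hM0 hε hC
  set T := max (max T₀ T₁) (max TB TA) with hT
  have hT0 : 0 < T := lt_of_lt_of_le hTB (le_trans (le_max_left _ _) (le_max_right _ _))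
  refine ⟨2 * L * KB + 2 * c * KA, T, by positivity, hT0, fun t ht => ?_⟩
  have ht0 : 0 ≤ t := le_trans hT0.le ht
  have hb0 := hT₀ t (le_trans (le_trans (le_max_left _ _) (le_max_left _ _)) ht)
  have hb1 := hT₁ t (le_trans (le_trans (le_max_right _ _) (le_max_left _ _)) ht)
  have hBt := hB t (le_trans (le_trans (le_max_left _ _) (le_max_right _ _)) ht)
  have hAt := hA t (le_trans (le_trans (le_max_right _ _) (le_max_right _ _)) ht)
  have hχ0 : 0 ≤ sphDecay lam t := (sphDecay_pos hlam (lt_of_lt_of_le hT0 ht)).le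
  have hφ0 : 0 < sph lam (hyp t) := sph_hyp_pos lam t
  -- the two exponents
  have he1 : Real.exp (-lam * t) * Real.exp (max (lam - ε) 0 * t) ≤ Real.exp (-(min ε lam) * t) := by
    rw [← Real.exp_add, Real.exp_le_exp]
    rcases le_total ε lam with h | h
    · rw [min_eq_left h, max_eq_left (by linarith)]; ring_nf; rfl
    · rw [min_eq_right h, max_eq_right (by linarith)]; ring_nf; rfl
  have he2 : Real.exp ((lam - 2) * t) * Real.exp (-(lam + ε - 2) * t) ≤ Real.exp (-(min ε lam) * t) := by
    rw [← Real.exp_add, Real.exp_le_exp]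
    have : min ε lam ≤ ε := min_le_left _ _
    nlinarith [this, ht0]
  unfold greenSolI
  calc |-(sphDecay lam t * greenBI (fun t => sph lam (hyp t)) g t) - sph lam (hyp t) * greenAI (sphDecay lam) g t|
      ≤ sphDecay lam t * |greenBI (fun t => sph lam (hyp t)) g t|
          + sph lam (hyp t) * |greenAI (sphDecay lam) g t| := by
        refine le_trans (abs_sub _ _) ?_
        rw [abs_neg, abs_mul, abs_mul, abs_of_nonneg hχ0, abs_of_pos hφ0]
    _ ≤ (2 * L * Real.exp (-lam * t)) * (KB * (1 + t) * Real.exp (max (lam - ε) 0 * t))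
          + (2 * c * Real.exp ((lam - 2) * t)) * (KA * Real.exp (-(lam + ε - 2) * t)) :=
        add_le_add (mul_le_mul hb0 hBt (abs_nonneg _) (by positivity))
          (mul_le_mul hb1 hAt (abs_nonneg _) (by positivity))
    _ = 2 * L * KB * (1 + t) * (Real.exp (-lam * t) * Real.exp (max (lam - ε) 0 * t))
          + 2 * c * KA * (Real.exp ((lam - 2) * t) * Real.exp (-(lam + ε - 2) * t)) := by ring
    _ ≤ 2 * L * KB * (1 + t) * Real.exp (-(min ε lam) * t)
          + 2 * c * KA * ((1 + t) * Real.exp (-(min ε lam) * t)) := by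
        refine add_le_add (mul_le_mul_of_nonneg_left he1 (by positivity)) ?_
        refine mul_le_mul_of_nonneg_left (le_trans he2 ?_) (by positivity)
        exact le_mul_of_one_le_left (Real.exp_pos _).le (by linarith)
    _ = (2 * L * KB + 2 * c * KA) * (1 + t) * Real.exp (-(min ε lam) * t) := by ring

include hlam hg hM hM0 hε hC in
/-- **`G^I_λ g` decays exponentially at every rate `ε′ < min(ε, λ)`**: `|G^I_λ g(t)| ≤ K e^{−ε′ t}` for `t ≥ T`. -/
theorem exists_abs_greenSolI_le_exp {ε' : ℝ} (hε' : ε' < min ε lam) :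
    ∃ K T : ℝ, 0 ≤ K ∧ 0 < T ∧ ∀ t, T ≤ t →
      |greenSolI (fun t => sph lam (hyp t)) (sphDecay lam) g t| ≤ K * Real.exp (-ε' * t) := by
  obtain ⟨K, T, hK, hT, hKT⟩ := abs_greenSolI_le_atTop hlam hg hM hM0 hε hC
  set δ := min ε lam - ε' with hδ
  have hδpos : 0 < δ := by rw [hδ]; linarith
  refine ⟨K * (1 + 1 / δ), T, by positivity, hT, fun t ht => ?_⟩
  have ht0 : 0 ≤ t := le_trans hT.le ht
  have h1 : 1 + t ≤ (1 + 1 / δ) * Real.exp (δ * t) := by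
    have ha : (1 : ℝ) ≤ Real.exp (δ * t) := Real.one_le_exp (by positivity)
    have hb : t ≤ Real.exp (δ * t) / δ := le_exp_div hδpos
    calc 1 + t ≤ Real.exp (δ * t) + Real.exp (δ * t) / δ := add_le_add ha hb
      _ = (1 + 1 / δ) * Real.exp (δ * t) := by ring
  have he : Real.exp (δ * t) * Real.exp (-(min ε lam) * t) = Real.exp (-ε' * t) := by
    rw [← Real.exp_add, hδ]
    congr 1
    ring
  calc |greenSolI (fun t => sph lam (hyp t)) (sphDecay lam) g t|
      ≤ K * (1 + t) * Real.exp (-(min ε lam) * t) := hKT t ht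
    _ ≤ K * ((1 + 1 / δ) * Real.exp (δ * t)) * Real.exp (-(min ε lam) * t) :=
        mul_le_mul_of_nonneg_right (mul_le_mul_of_nonneg_left h1 hK) (Real.exp_pos _).le
    _ = K * (1 + 1 / δ) * Real.exp (-ε' * t) := by rw [← he]; ring

end measure

end Summit.Ventures.HodgeRepro2.T5SU11RadialGreenImproperStable
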